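import Summits.AtomisticToContinuum.Crystallization.Theorems.FrustratedLawDichotomyCellLabelList

/-!
# FrustratedLawDichotomy · crux `AperiodicFrustratedLawGap` (stmt-AtomisticToContinuum-27623) — COMPANION TO FRAME FILE R «CellLabelList»:
# COMPUTED-LABEL MEMBERSHIP, THE OFF-LIST DIRECTION, LIST-BACKED BALLS AND ROOT-ERASED FOLDS (decomp-a2c hand-1 g54; lens-5 COORD l.9598 (a))

Five DEF-FREE facts over (316) `…CellLabelList` (lens-5 g113) that the Floor files of the LABELS-SCALE K-files call and R does not carry:

* ★ `mem_boxL_of_sqT_lt` — `|m|² < (R + 1)² ⇒ m ∈ boxL R` (window labels, ball lists, mirrors `2m − m'`, closure images are INSIDE the box);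
* ★ `mem_labL_of` / `mem_toFinset_labL_of` — membership of a COMPUTED label from the admissibility Boolean and the squared norm, ONE step;
* ★ `sqT_ge_of_not_mem_labL` / `win_false_of_not_mem_labL` — the OFF-LIST direction: an admissible (resp. parity-admissible) label NOT in the
  list is outside the box (resp. fails the window Boolean) — the `hoff`/`hfar` input of (p860245 §5) `offWindow_of_predicate` /
  `hfar_of_intWindow` and hence of `hout_of_nearId` (window completeness of the mirror host column);
* `mem_ballL_toFinset` — membership in the (261) lists of a list-backed label set BY PREDICATE;
* `sum_erase_toFinset` — the root-erased tally `Σ_{m ∈ L.toFinset ∖ a} f m` as ONE list fold (any additive monoid: `ℚ` folds for the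
  certificate, `ℝ` for the master), `sum_filter_toFinset` likewise for filtered sub-lists (`MN`, `ML`).
DEF-FREE; imports TREE (316) `…CellLabelList`; 0 sorry.  All `[folklore]`.
-/

namespace Summit.AtomisticToContinuum.Crystallization.Theorems.FrustratedLawDichotomyCellLabelListFacts

open scoped BigOperators
open Summit.AtomisticToContinuum.Crystallization.Theorems.FrustratedLawDichotomyCellClasses (ballL)
open Summit.AtomisticToContinuum.Crystallization.Theorems.FrustratedLawDichotomyCellTriples
open Summit.AtomisticToContinuum.Crystallization.Theorems.FrustratedLawDichotomyCellLabelList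

/-! ## §1. Computed labels are in the box / in the list -/

/-- ★ a triple of squared norm `< (R + 1)²` lies in the enumeration box. [folklore] -/
theorem mem_boxL_of_sqT_lt {R : ℕ} {m : ℤ × ℤ × ℤ} (h : sqT m < ((R : ℤ) + 1) ^ 2) : m ∈ boxL R := by
  obtain ⟨a, b, c⟩ := m
  simp only [sqT] at h
  rw [mem_boxL]
  have ha : a ^ 2 < ((R : ℤ) + 1) ^ 2 := by nlinarith [sq_nonneg b, sq_nonneg c]
  have hb : b ^ 2 < ((R : ℤ) + 1) ^ 2 := by nlinarith [sq_nonneg a, sq_nonneg c]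
  have hc : c ^ 2 < ((R : ℤ) + 1) ^ 2 := by nlinarith [sq_nonneg a, sq_nonneg b]
  have hR : (0 : ℤ) ≤ (R : ℤ) + 1 := by positivity
  have ha' := abs_lt_of_sq_lt_sq' ha hR
  have hb' := abs_lt_of_sq_lt_sq' hb hR
  have hc' := abs_lt_of_sq_lt_sq' hc hR
  simp only
  omega

/-- ★ MEMBERSHIP OF A COMPUTED LABEL (closure image, mirror, cover point): admissible and of squared norm `< (R + 1)²` ⇒ in the list —
no list search. [folklore] -/
theorem mem_labL_of {R : ℕ} {adm : ℤ × ℤ × ℤ → Bool} {m : ℤ × ℤ × ℤ} (hadm : adm m = true) (hsq : sqT m < ((R : ℤ) + 1) ^ 2) :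
    m ∈ labL R adm :=
  mem_labL.mpr ⟨mem_boxL.mp (mem_boxL_of_sqT_lt hsq), hadm⟩

/-- the same for the cell's label SET `(labL R adm).toFinset`. [folklore] -/
theorem mem_toFinset_labL_of {R : ℕ} {adm : ℤ × ℤ × ℤ → Bool} {m : ℤ × ℤ × ℤ} (hadm : adm m = true)
    (hsq : sqT m < ((R : ℤ) + 1) ^ 2) : m ∈ (labL R adm).toFinset :=
  List.mem_toFinset.mpr (mem_labL_of hadm hsq)

/-! ## §2. The off-list direction (window completeness) -/

/-- ★ OFF THE LIST, an admissible label is OUTSIDE the box: `(R + 1)² ≤ |m|²`. [folklore] -/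
theorem sqT_ge_of_not_mem_labL {R : ℕ} {adm : ℤ × ℤ × ℤ → Bool} {m : ℤ × ℤ × ℤ} (hadm : adm m = true) (hm : m ∉ labL R adm) :
    ((R : ℤ) + 1) ^ 2 ≤ sqT m := by
  by_contra h
  exact hm (mem_labL_of hadm (lt_of_not_ge h))

/-- ★ WINDOW COMPLETENESS in Boolean form: with admissibility `par m && win m` and a box that contains the window (`win m ⇒ |m|² < (R+1)²`),
a parity-admissible label NOT in the list FAILS the window test — the `hoff` input of (p860245 §5) `offWindow_of_predicate`/`hfar_of_intWindow`.
[folklore] -/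
theorem win_false_of_not_mem_labL {R : ℕ} {par win : ℤ × ℤ × ℤ → Bool} (hbox : ∀ m, win m = true → sqT m < ((R : ℤ) + 1) ^ 2)
    {m : ℤ × ℤ × ℤ} (hpar : par m = true) (hm : m ∉ labL R fun x => par x && win x) : win m = false := by
  by_contra hw
  rw [Bool.not_eq_false] at hw
  exact hm (mem_labL_of (by simp [hpar, hw]) (hbox m hw))

/-- the same from the label SET. [folklore] -/
theorem win_false_of_not_mem_toFinset {R : ℕ} {par win : ℤ × ℤ × ℤ → Bool} (hbox : ∀ m, win m = true → sqT m < ((R : ℤ) + 1) ^ 2)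
    {m : ℤ × ℤ × ℤ} (hpar : par m = true) (hm : m ∉ (labL R fun x => par x && win x).toFinset) : win m = false :=
  win_false_of_not_mem_labL hbox hpar (fun h => hm (List.mem_toFinset.mpr h))

/-! ## §3. List-backed balls and root-erased / filtered folds -/

/-- membership in the (261) integer-radius list of a list-backed label set BY PREDICATE. [folklore] -/
theorem mem_ballL_toFinset {L : List (ℤ × ℤ × ℤ)} {ℓ : ℤ} {c x : ℤ × ℤ × ℤ} :
    x ∈ ballL L.toFinset zT ℓ c ↔ x ∈ L ∧ sqT (subT x c) < ℓ := by
  rw [mem_ballL_zT, List.mem_toFinset]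

section Folds

variable {ι : Type*} [DecidableEq ι] {β : Type*} [AddCommMonoid β]

/-- ★ the ROOT-ERASED tally as ONE list fold (any additive monoid; `Nodup` is R's structural `nodup_labL`). [folklore] -/
theorem sum_erase_toFinset {L : List ι} (hL : L.Nodup) (a : ι) (f : ι → β) :
    ∑ m ∈ L.toFinset.erase a, f m = ((L.filter fun x => decide (x ≠ a)).map f).sum := by
  rw [erase_toFinset, List.sum_toFinset f (hL.filter _)]

/-- a FILTERED tally (`MN`, `ML`, near lists) as ONE list fold. [folklore] -/
theorem sum_filter_toFinset {L : List ι} (hL : L.Nodup) (p : ι → Prop) [DecidablePred p] (f : ι → β) :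
    ∑ m ∈ L.toFinset.filter p, f m = ((L.filter fun x => decide (p x)).map f).sum := by
  rw [filter_toFinset, List.sum_toFinset f (hL.filter _)]

end Folds

end Summit.AtomisticToContinuum.Crystallization.Theorems.FrustratedLawDichotomyCellLabelListFacts
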